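import Literature.AnabelianGeometry.EtaleTheta.SettingModelKrullCusp
import Literature.AnabelianGeometry.EtaleTheta.SettingModelChiTwistInversion
import Literature.AnabelianGeometry.EtaleTheta.SettingModelSigmaHatFacts
import Literature.AnabelianGeometry.EtaleTheta.ThetaCoversAxOfSetting
import Literature.AnabelianGeometry.EtaleTheta.Discharge.Sec2InvEllOfCLevel
import Literature.AnabelianGeometry.EtaleTheta.Discharge.Sec2InertiaOfCommutatorAxis
import Literature.AnabelianGeometry.EtaleTheta.Discharge.Sec2Prop22InvThetaOfInvEll
import Literature.AnabelianGeometry.EtaleTheta.Discharge.Sec1ThetaCompanionOfAut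
import Mathlib.Topology.Instances.ZMod
import HarnessLib

/-!
# `coverDataAx` FULLY INSTANTIATED at the cusped untwisted Krull model `modelκ′`: a `PiCData` on
# `Π_C := Π_X ⋊_{ι̂} ℤ/2` at which ALL THREE printed binders hIx, hιell, hιtheta are THEOREMS

S. Mochizuki, *The étale theta function …*, Publ. RIMS **45** (2009) [EtTh], §2 pp. 35–37 (printed 261–263): Def. 2.1 and
the discussion before it («`I_x ⊆ D_x` isomorphically onto `Δ̄_Θ`», «`ι` … multiplication by `−1`»), Prop. 2.2 (i)(ii)(iii)
[cite: MochizukiEtTh2009, Def 2.1 p.36]. Cell abc-iut, layer L2, seat abc-iut-L2-t10 (gen 5), row «coverDataAx FULLY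
INSTANTIATED», K4 = the payoff over K1a–K3b (`SettingModelKrull{Coverings,Semidirect,Theta,GroupLevel,Cusp}`). At
`ThetaSetting.modelκ′ p` (`Π^tp_X = Γ ⋊_{θ∘1} G_{ℚ_p}`, commutator-axis cusp, `OncePuncturedData` with NO binder):
§0 the twisted inversion `ι := twistedInversionTop 1` with (R1e′) (`ι̂ = σ̂ ⋊ id` by density, as p436289); §1–§2
`Π_C := Π_X ⋊_{ι̂} ℤ/2` and **`piCDataκ'`** (as p437944); §3 **`piCDataκ'_inv_ell` / `_inv_theta`** (P-C4 via p432126 /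
abc-iut-L6-d6); §4 **`piCDataκ'_hIx`** (P-C3 via this seat's bridge p434006 at K3b's `map_toHat_inertia_modelκ'`, compact
`D_x`), hence **`coverDataAxκ l hodd : ThetaCovers.CoverDataAx l`** = `PiCData.coverDataAx` (p428054) BUILT WITH ZERO
BINDERS and **[EtTh] Prop. 2.2 (i)(ii)(iii) INSTANTIATED** (`prop22_i/ii/iii_modelκ'`). HONEST LIMITS: semi-synthetic
model, consistency evidence only (trivial Galois action on `Γ`; `Π_C` profinite, not a tempered `Π^tp_C`); class (b)
(instances on the NEW carrier `PiCκ` only, no `Prop` fact); nothing of [EtTh] asserted; no side taken on [IUTchIII]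
Cor. 3.12; typed ≠ proved.
-/

noncomputable section

namespace Literature.AnabelianGeometry.EtaleTheta.SettingModel

open scoped commutatorElement
open Literature.AnabelianGeometry.SemiGraphs _root_.Topology _root_.Function

variable (p : ℕ) [Fact p.Prime]

/-! ## §0. The twisted inversion of `Π^tp_X = Γ ⋊_{θ∘1} G_{ℚ_p}` and (R1e′) -/

/-- `σ̂` commutes with the `Ẑ^×`-twists through `κ` (abc-iut-w5-d024's `sigmaHat_twist`), in the shape
`SemidirectProduct.congr` wants. [cite: MochizukiEtTh2009, §2 p.36] -/
theorem actHatκ_trans_sigmaHatEquiv (σ : GQp p) :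
    (actHatκ p σ).trans sigmaHatEquiv.toMulEquiv = sigmaHatEquiv.toMulEquiv.trans (actHatκ p σ) :=
  MulEquiv.ext fun x => sigmaHat_twist ((1 : GQp p →* MulAut ZH) σ) x

/-- **The completed twisted inversion is `σ̂ ⋊ id` on `Π_X = F̂₂ ⋊_κ G_{ℚ_p}`**: for `ι := twistedInversionTop κ`
on `Π^tp_X = Γ ⋊_κ G_{ℚ_p}`, `completionAut ι = SemidirectProduct.congr σ̂ id` (both are continuous and agree on
the dense image of `Π^tp_X`, where `pr₁ (ι_Γ γ) = σ̂ (pr₁ γ)`). [cite: MochizukiEtTh2009, §2 p.36] -/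
theorem completionAut_twistedInversion_modelκ'_apply (z : PiHtκ p) :
    (ThetaSetting.modelκ' p).completionAut (twistedInversionTop (1 : GQp p →* MulAut ZH) (isInducing_leftRightκ p)) z =
      SemidirectProduct.congr sigmaHatEquiv.toMulEquiv (MulEquiv.refl (GQp p)) (actHatκ_trans_sigmaHatEquiv p) z := by
  set ι := twistedInversionTop (1 : GQp p →* MulAut ZH) (isInducing_leftRightκ p) with hι
  let ΨE : PiHtκ p ≃* PiHtκ p :=
    SemidirectProduct.congr sigmaHatEquiv.toMulEquiv (MulEquiv.refl (GQp p)) (actHatκ_trans_sigmaHatEquiv p)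
  have hΨc : Continuous ΨE := by
    rw [(isInducing_leftRightHatκ p).continuous_iff]
    have h : ((fun g : PiHtκ p => (g.left, g.right)) ∘ ΨE) =
        Prod.map sigmaHat id ∘ fun g : PiHtκ p => (g.left, g.right) := by
      funext g; rfl
    rw [h]
    exact (sigmaHat.continuous.prodMap continuous_id).comp (isInducing_leftRightHatκ p).continuous
  let Ψ : PiHtκ p →ₜ* PiHtκ p := { toMonoidHom := ΨE.toMonoidHom, continuous_toFun := hΨc }
  let Φ : PiHtκ p →ₜ* PiHtκ p :=
    { toMonoidHom := ((ThetaSetting.modelκ' p).completionAut ι).toMulEquiv.toMonoidHom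
      continuous_toFun := ((ThetaSetting.modelκ' p).completionAut ι).continuous }
  have hΦΨ : Φ = Ψ := by
    refine IsProfiniteCompletion.extension_unique (ThetaSetting.modelκ' p).isProfiniteCompletion_toHat Φ Ψ fun x => ?_
    change (ThetaSetting.modelκ' p).completionAut ι ((ThetaSetting.modelκ' p).toHat x) =
      ΨE ((ThetaSetting.modelκ' p).toHat x)
    rw [TemperedCurve.completionAut_toHat]
    change toHatκ p (twistedInversion (1 : GQp p →* MulAut ZH) x) = ΨE (toHatκ p x)
    exact SemidirectProduct.ext rfl rfl
  exact DFunLike.congr_fun (congrArg ContinuousMonoidHom.toMonoidHom hΦΨ) z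

/-- On the normal factor: `ι̂ (inl x) = inl (σ̂ x)`. [cite: MochizukiEtTh2009, §2 p.36] -/
theorem completionAut_twistedInversion_modelκ'_inl (x : F₂hatT) :
    (ThetaSetting.modelκ' p).completionAut (twistedInversionTop (1 : GQp p →* MulAut ZH) (isInducing_leftRightκ p))
        (SemidirectProduct.inl x) = SemidirectProduct.inl (sigmaHat x) := by
  rw [completionAut_twistedInversion_modelκ'_apply]
  exact SemidirectProduct.ext rfl rfl

/-- `inl : F̂₂ → Π_X` carries `⁅F̂₂, F̂₂⁆⁻` into `⁅Δ̂_X, Δ̂_X⁆⁻` (`inl(F̂₂) ⊆ Δ̂_X`, `inl` continuous).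
[cite: MochizukiEtTh2009, §1 p.12] -/
theorem inl_mem_closure_commutator_deltaHatκ {y : F₂hatT} (hy : y ∈ (commutator F₂hatT).topologicalClosure) :
    (SemidirectProduct.inl y : PiHtκ p) ∈
      (⁅(curveκ p).DeltaHat, (curveκ p).DeltaHat⁆).topologicalClosure := by
  have hle : (commutator F₂hatT).map (SemidirectProduct.inl : F₂hatT →* PiHtκ p) ≤
      ⁅(curveκ p).DeltaHat, (curveκ p).DeltaHat⁆ := by
    rw [commutator_def, Subgroup.map_commutator]
    have h : (⊤ : Subgroup F₂hatT).map (SemidirectProduct.inl : F₂hatT →* PiHtκ p) ≤ (curveκ p).DeltaHat := by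
      rintro _ ⟨x, -, rfl⟩
      exact inl_mem_deltaHatκ p x
    exact Subgroup.commutator_mono h h
  have hsub : (SemidirectProduct.inl : F₂hatT → PiHtκ p) '' (commutator F₂hatT : Set F₂hatT) ⊆
      ((⁅(curveκ p).DeltaHat, (curveκ p).DeltaHat⁆ : Subgroup (PiHtκ p)) : Set (PiHtκ p)) := by
    rintro _ ⟨x, hx, rfl⟩
    exact hle ⟨x, hx, rfl⟩
  have hmem : (SemidirectProduct.inl y : PiHtκ p) ∈
      closure ((SemidirectProduct.inl : F₂hatT → PiHtκ p) '' (commutator F₂hatT : Set F₂hatT)) := by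
    refine image_closure_subset_closure_image (Semidirect.continuous_inl (isInducing_leftRightHatκ p)) ⟨y, ?_, rfl⟩
    rwa [← Subgroup.topologicalClosure_coe]
  have key := closure_mono hsub hmem
  rwa [← Subgroup.topologicalClosure_coe] at key

/-- **(R1e′) HOLDS at `modelκ′`**: for the twisted inversion `ι := twistedInversionTop κ` of `Π^tp_X = Γ ⋊_κ G_{ℚ_p}`,
`ι̂ g · g ∈ ⁅Δ̂_X, Δ̂_X⁆⁻` for every `g ∈ Δ̂_X` («`ι̂ ≡ −1` on `Δ_X^ab`», the C-level ORIGIN CLAUSE to which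
G-L2t10-4 (a) hιell was reduced in `Discharge/Sec2InvEllOfCLevel`); the `F̂₂`-level input `σ̂(x)·x ∈ ⁅F̂₂,F̂₂⁆⁻`
is abc-iut-w5-d072's `sigmaHat_mul_self_mem_closure_commutator` (`SettingModelSigmaHatFacts`). [cite: MochizukiEtTh2009, Prop 2.2 (i) p.37] -/
theorem twistedInversion_hinv_modelκ' :
    ∀ g ∈ (ThetaSetting.modelκ' p).DeltaHat,
      (ThetaSetting.modelκ' p).completionAut (twistedInversionTop (1 : GQp p →* MulAut ZH) (isInducing_leftRightκ p)) g * g ∈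
        (⁅(ThetaSetting.modelκ' p).DeltaHat, (ThetaSetting.modelκ' p).DeltaHat⁆).topologicalClosure := by
  intro g hg
  have hg1 : g.right = 1 := right_eq_one_of_mem_deltaHatκ p hg
  have hgeq : g = SemidirectProduct.inl g.left := by
    rw [← SemidirectProduct.inl_left_mul_inr_right g, hg1, map_one, mul_one]
    rfl
  rw [hgeq, completionAut_twistedInversion_modelκ'_inl, ← map_mul]
  exact inl_mem_closure_commutator_deltaHatκ p (sigmaHat_mul_self_mem_closure_commutator g.left)

/-! ## §1. The completed inversion `ι̂ = σ̂ ⋊ id` of `Π_X = F̂₂ ⋊_κ G_{ℚ_p}` and the carrier `Π_C := Π_X ⋊_{ι̂} ℤ/2` -/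

/-- **`ι̂ := σ̂ ⋊ id ∈ Aut(Π_X)`** — the completed twisted inversion (`completionAut_twistedInversion_modelκ'_apply`).
[cite: MochizukiEtTh2009, §2 p.36] -/
def hatInvκ : MulAut (PiHtκ p) :=
  SemidirectProduct.congr sigmaHatEquiv.toMulEquiv (MulEquiv.refl (GQp p)) (actHatκ_trans_sigmaHatEquiv p)

/-- [cite: MochizukiEtTh2009, §2 p.36] -/
@[simp] theorem hatInvκ_left (z : PiHtκ p) : (hatInvκ p z).left = sigmaHat z.left := rfl

/-- [cite: MochizukiEtTh2009, §2 p.36] -/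
@[simp] theorem hatInvκ_right (z : PiHtκ p) : (hatInvκ p z).right = z.right := rfl

/-- `ι̂` is an involution. [cite: MochizukiEtTh2009, §2 p.36] -/
@[simp] theorem hatInvκ_hatInvκ (z : PiHtκ p) : hatInvκ p (hatInvκ p z) = z :=
  SemidirectProduct.ext (by rw [hatInvκ_left, hatInvκ_left, sigmaHat_sigmaHat]) rfl

/-- `ι̂ · ι̂ = 1` in `Aut(Π_X)`. [cite: MochizukiEtTh2009, §2 p.36] -/
theorem hatInvκ_mul_hatInvκ : hatInvκ p * hatInvκ p = 1 := MulEquiv.ext fun z => hatInvκ_hatInvκ p z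

/-- `ι̂` IS the completed twisted inversion of the model (`ThetaSetting.modelκ′`). [cite: MochizukiEtTh2009, §2 p.36] -/
theorem hatInvκ_eq_completionAut (z : PiHtκ p) :
    hatInvκ p z = (ThetaSetting.modelκ' p).completionAut (twistedInversionTop (1 : GQp p →* MulAut ZH) (isInducing_leftRightκ p)) z :=
  (completionAut_twistedInversion_modelκ'_apply p z).symm

/-- `ι̂` is continuous. [cite: MochizukiEtTh2009, §2 p.36] -/
theorem continuous_hatInvκ : Continuous (hatInvκ p) := by
  rw [(isInducing_leftRightHatκ p).continuous_iff]
  have h : ((fun g : PiHtκ p => (g.left, g.right)) ∘ hatInvκ p) =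
      Prod.map sigmaHat id ∘ fun g : PiHtκ p => (g.left, g.right) := by
    funext g; rfl
  rw [h]
  exact (sigmaHat.continuous.prodMap continuous_id).comp (isInducing_leftRightHatκ p).continuous

/-- **The action `ℤ/2 → Aut(Π_X)`, generator `↦ ι̂`** (well defined since `ι̂² = 1`). [cite: MochizukiEtTh2009, §2 p.36] -/
def hatInvActionκ : Multiplicative (ZMod 2) →* MulAut (PiHtκ p) where
  toFun z := if z = 1 then 1 else hatInvκ p
  map_one' := if_pos rfl
  map_mul' a b := by
    have key : ∀ z : Multiplicative (ZMod 2), z = 1 ∨ z = Multiplicative.ofAdd 1 := by decide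
    have hne : (Multiplicative.ofAdd (1 : ZMod 2)) ≠ 1 := by decide
    have hsq : Multiplicative.ofAdd (1 : ZMod 2) * Multiplicative.ofAdd 1 = 1 := by decide
    rcases key a with rfl | rfl <;> rcases key b with rfl | rfl
    · simp
    · simp [hne]
    · simp [hne]
    · rw [hsq, if_pos rfl, if_neg hne, hatInvκ_mul_hatInvκ]

/-- The generator acts by `ι̂`. [cite: MochizukiEtTh2009, §2 p.36] -/
theorem hatInvActionκ_ofAdd_one : hatInvActionκ p (Multiplicative.ofAdd 1) = hatInvκ p := by
  change (if Multiplicative.ofAdd (1 : ZMod 2) = 1 then (1 : MulAut (PiHtκ p)) else hatInvκ p) = _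
  rw [if_neg (by decide)]

/-- Every `φ(z)` is `1` or `ι̂`; in either case it is continuous and over `G_{ℚ_p}`.
[cite: MochizukiEtTh2009, §2 p.36] -/
theorem hatInvActionκ_eq_one_or (z : Multiplicative (ZMod 2)) : hatInvActionκ p z = 1 ∨ hatInvActionκ p z = hatInvκ p := by
  have key : ∀ z : Multiplicative (ZMod 2), z = 1 ∨ z = Multiplicative.ofAdd 1 := by decide
  rcases key z with rfl | rfl
  · exact Or.inl (map_one _)
  · exact Or.inr (hatInvActionκ_ofAdd_one p)

/-- `augHat (φ(z) x) = augHat x`. [cite: Mochizuki2012, Rmk 1.4.1 (ii) p.28] -/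
theorem augHatκ_hatInvActionκ (z : Multiplicative (ZMod 2)) (x : PiHtκ p) :
    augHatκ p (hatInvActionκ p z x) = augHatκ p x := by
  rcases hatInvActionκ_eq_one_or p z with h | h <;> rw [h]
  · rfl
  · rfl

/-- **`Π_C := Π_X ⋊_{ι̂} ℤ/2`** — the model of the profinite étale fundamental group of `C^log = X^log/{ι}` at the
cusped κ-model (p. 36). A type synonym of Mathlib's semidirect product (instances below live on it only).
[cite: MochizukiEtTh2009, Def 2.1 p.36] -/
abbrev PiCκ : Type := PiHtκ p ⋊[hatInvActionκ p] Multiplicative (ZMod 2)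

/-- The topology of `Π_C`: induced along `g ↦ (g.left, g.right) ∈ Π_X × ℤ/2`. [cite: MochizukiEtTh2009, Def 2.1 p.36] -/
instance instTopologicalSpacePiCκ : TopologicalSpace (PiCκ p) :=
  TopologicalSpace.induced (fun g : PiCκ p => (g.left, g.right)) inferInstance

/-- [cite: MochizukiEtTh2009, Def 2.1 p.36] -/
theorem isInducing_leftRightCκ : IsInducing fun g : PiCκ p => (g.left, g.right) := ⟨rfl⟩

/-- The action map `(z, x) ↦ φ(z) x` is jointly continuous (`ℤ/2` discrete, `ι̂` continuous).
[cite: MochizukiEtTh2009, Def 2.1 p.36] -/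
theorem continuous_hatInvActionκ_uncurry :
    Continuous fun q : Multiplicative (ZMod 2) × PiHtκ p => hatInvActionκ p q.1 q.2 := by
  refine continuous_prod_of_discrete_left.mpr fun z => ?_
  rcases hatInvActionκ_eq_one_or p z with h | h
  · simp only [h, MulAut.one_apply]; exact continuous_id
  · simp only [h]; exact continuous_hatInvκ p

/-- `Π_C` is a topological group. [cite: MochizukiEtTh2009, Def 2.1 p.36] -/
instance instIsTopologicalGroupPiCκ : IsTopologicalGroup (PiCκ p) :=
  Semidirect.isTopologicalGroup_of_continuous_action (isInducing_leftRightCκ p) (continuous_hatInvActionκ_uncurry p)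

/-- `Π_C` is compact. [cite: MochizukiEtTh2009, Def 2.1 p.36] -/
instance instCompactSpacePiCκ : CompactSpace (PiCκ p) := Semidirect.compactSpace_of (isInducing_leftRightCκ p)

/-- `Π_C` is Hausdorff. [cite: MochizukiEtTh2009, Def 2.1 p.36] -/
instance instT2SpacePiCκ : T2Space (PiCκ p) := Semidirect.t2Space_of (isInducing_leftRightCκ p)

/-- `Π_C` is totally disconnected (profinite). [cite: MochizukiEtTh2009, Def 2.1 p.36] -/
instance instTotallyDisconnectedSpacePiCκ : TotallyDisconnectedSpace (PiCκ p) :=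
  Semidirect.totallyDisconnectedSpace_of (isInducing_leftRightCκ p)

/-- `augHat ∘ φ(z) = augHat` in the form `SemidirectProduct.lift` wants (trivial second component).
[cite: Mochizuki2012, Rmk 1.4.1 (ii) p.28] -/
theorem augHatκ_comp_hatInvActionκ (z : Multiplicative (ZMod 2)) :
    (augHatκ p).toMonoidHom.comp (hatInvActionκ p z).toMonoidHom =
      (MulAut.conj ((1 : Multiplicative (ZMod 2) →* GQp p) z)).toMonoidHom.comp (augHatκ p).toMonoidHom := by
  refine MonoidHom.ext fun x => ?_
  simp only [MonoidHom.comp_apply, MulEquiv.coe_toMonoidHom, MonoidHom.one_apply, map_one, MulAut.one_apply]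
  exact augHatκ_hatInvActionκ p z x

/-- **The augmentation `Π_C → G_{ℚ_p}`**: `(x, z) ↦ augHat x` (a homomorphism because `ι̂` is over `G_{ℚ_p}`),
continuous. [cite: MochizukiEtTh2009, Def 2.1 p.36] -/
def augCκ : PiCκ p →ₜ* GQp p where
  toMonoidHom := SemidirectProduct.lift (augHatκ p).toMonoidHom 1 (augHatκ_comp_hatInvActionκ p)
  continuous_toFun := by
    change Continuous fun g : PiCκ p =>
      SemidirectProduct.lift (augHatκ p).toMonoidHom 1 (augHatκ_comp_hatInvActionκ p) g
    have h : (fun g : PiCκ p => SemidirectProduct.lift (augHatκ p).toMonoidHom 1 (augHatκ_comp_hatInvActionκ p) g) =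
        fun g => augHatκ p g.left := by
      funext g
      change (augHatκ p).toMonoidHom g.left * (1 : Multiplicative (ZMod 2) →* GQp p) g.right = _
      rw [MonoidHom.one_apply, mul_one]
      rfl
    rw [h]
    exact (augHatκ p).continuous.comp (Semidirect.continuous_left (isInducing_leftRightCκ p))

/-- `augC (inl x) = augHat x`. [cite: MochizukiEtTh2009, Def 2.1 p.36] -/
theorem augCκ_inl (x : PiHtκ p) : augCκ p (SemidirectProduct.inl x) = augHatκ p x :=
  SemidirectProduct.lift_inl (augHatκ p).toMonoidHom 1 (augHatκ_comp_hatInvActionκ p) x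

/-- `augC (x, z) = augHat x`. [cite: MochizukiEtTh2009, Def 2.1 p.36] -/
theorem augCκ_apply (g : PiCκ p) : augCκ p g = augHatκ p g.left := by
  change (augHatκ p).toMonoidHom g.left * (1 : Multiplicative (ZMod 2) →* GQp p) g.right = _
  rw [MonoidHom.one_apply, mul_one]
  rfl

/-! ## §2. The inhabitant of `PiCData` at `modelκ′` -/

/-- **`Π_C ⊇ Π_X ↠ G_K` at the cusped κ-model, with the genuine inversion** — an inhabitant of
`ThetaSetting.PiCData (ThetaSetting.modelκ′ p) (PiCκ p)`: `incl := inl`, `aug := augCκ`.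
[cite: MochizukiEtTh2009, Def 2.1 p.36] -/
def piCDataκ' : (ThetaSetting.modelκ' p).PiCData (PiCκ p) where
  incl := ⟨SemidirectProduct.inl, Semidirect.continuous_inl (isInducing_leftRightCκ p)⟩
  incl_injective := SemidirectProduct.inl_injective
  range_normal := by
    change (SemidirectProduct.inl : PiHtκ p →* PiCκ p).range.Normal
    rw [SemidirectProduct.range_inl_eq_ker_rightHom]
    infer_instance
  index_range := by
    change (SemidirectProduct.inl : PiHtκ p →* PiCκ p).range.index = 2
    rw [SemidirectProduct.range_inl_eq_ker_rightHom, Subgroup.index_ker,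
      MonoidHom.range_eq_top.mpr SemidirectProduct.rightHom_surjective, Subgroup.card_top]
    change Nat.card (ZMod 2) = 2
    exact Nat.card_zmod 2
  aug := augCκ p
  aug_incl g := augCκ_inl p g
  range_aug := by
    change (augCκ p).toMonoidHom.range = (⊥ : IntermediateField ℚ_[p] (PadicAlgCl p)).fixingSubgroup
    rw [IntermediateField.fixingSubgroup_bot]
    refine MonoidHom.range_eq_top.mpr fun σ => ⟨SemidirectProduct.inl (SemidirectProduct.inr σ), ?_⟩
    change augCκ p (SemidirectProduct.inl (SemidirectProduct.inr σ)) = σ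
    rw [augCκ_inl]
    rfl

/-- `incl = inl` on elements. [cite: MochizukiEtTh2009, Def 2.1 p.36] -/
@[simp] theorem piCDataκ'_incl_apply (x : PiHtκ p) : (piCDataκ' p).incl x = SemidirectProduct.inl x := rfl

/-- `aug = augCκ`. [cite: MochizukiEtTh2009, Def 2.1 p.36] -/
theorem piCDataκ'_aug : (piCDataκ' p).aug = augCκ p := rfl

/-- **`ε := (1, 1̄) ∈ Π_C`** lifts the generator of `Gal(X/C)`; it is GEOMETRIC (`aug ε = 1`) and not in `Π_X`.
[cite: MochizukiEtTh2009, §2 p.36] -/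
theorem inr_one_mem_ker_not_mem_PiX_κ :
    (SemidirectProduct.inr (Multiplicative.ofAdd (1 : ZMod 2)) : PiCκ p) ∈ (piCDataκ' p).augGK.ker ∧
      (SemidirectProduct.inr (Multiplicative.ofAdd (1 : ZMod 2)) : PiCκ p) ∉ (piCDataκ' p).PiX := by
  constructor
  · rw [(piCDataκ' p).mem_ker_augGK, piCDataκ'_aug, augCκ_apply, SemidirectProduct.left_inr, map_one]
  · rintro ⟨y, hy⟩
    have h := congrArg SemidirectProduct.rightHom hy
    change SemidirectProduct.rightHom (SemidirectProduct.inl y) =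
      SemidirectProduct.rightHom (SemidirectProduct.inr (Multiplicative.ofAdd (1 : ZMod 2))) at h
    rw [SemidirectProduct.rightHom_inl, SemidirectProduct.rightHom_inr] at h
    exact absurd h (by decide)

/-- **`ε · inl x · ε⁻¹ = inl (ι̂ x)`**: conjugation by `ε` IS the completed inversion (Mathlib `inl_aut`).
[cite: MochizukiEtTh2009, §2 p.36] -/
theorem inr_one_conj_inl_κ (x : PiHtκ p) :
    (SemidirectProduct.inr (Multiplicative.ofAdd (1 : ZMod 2)) : PiCκ p) * SemidirectProduct.inl x *
        (SemidirectProduct.inr (Multiplicative.ofAdd (1 : ZMod 2)))⁻¹ = SemidirectProduct.inl (hatInvκ p x) := by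
  have h := SemidirectProduct.inl_aut (φ := hatInvActionκ p) (Multiplicative.ofAdd (1 : ZMod 2)) x
  rw [hatInvActionκ_ofAdd_one] at h
  rw [← map_inv]
  exact h.symm

/-! ## §3. The eigenvalue binders hιell / hιtheta HOLD at `piCDataκ'` (hIx: §4) -/

/-- **hιell HOLDS at `piCDataκ'` (consumer form)**: every `c ∈ Ker(Π_C ↠ G_K) ∖ Π_X` acts on `Δ̄^ell_X` by `−1`,
i.e. `c · d · c⁻¹ · d ∈ barTheta l` for all `d ∈ Π_X ∩ Δ_C` — from ONE `c₁ := ε` (`PiCData.inv_ell_of_one`),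
where `ε · inl d · ε⁻¹ · inl d = inl (ι̂ d · d)` lies in `inl(⁅Δ̂_X, Δ̂_X⁆⁻) ⊆ barTheta l` by the (R1e′) clause
`twistedInversion_hinv_modelκ'`. [cite: MochizukiEtTh2009, Prop 2.2 (i) p.37] -/
theorem piCDataκ'_inv_ell (l : ℕ) (e : (ThetaSetting.modelκ' p).OncePuncturedData) :
    ∀ c ∈ (piCDataκ' p).augGK.ker, c ∉ (piCDataκ' p).PiX →
      ∀ d ∈ (piCDataκ' p).PiX ⊓ (piCDataκ' p).augGK.ker, c * d * c⁻¹ * d ∈ (piCDataκ' p).barTheta l := by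
  obtain ⟨hε, hεX⟩ := inr_one_mem_ker_not_mem_PiX_κ p
  refine (piCDataκ' p).inv_ell_of_one l e hε hεX fun d hd => ?_
  rw [← (piCDataκ' p).deltaX_eq e] at hd
  obtain ⟨y, hy, rfl⟩ := hd
  change (SemidirectProduct.inr (Multiplicative.ofAdd (1 : ZMod 2)) : PiCκ p) * SemidirectProduct.inl y *
      (SemidirectProduct.inr (Multiplicative.ofAdd (1 : ZMod 2)))⁻¹ * SemidirectProduct.inl y ∈ _
  rw [inr_one_conj_inl_κ, ← map_inl_mul]
  · refine (piCDataκ' p).map_closure_commutator_le_barTheta l ⟨hatInvκ p y * y, ?_, rfl⟩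
    rw [hatInvκ_eq_completionAut]
    exact twistedInversion_hinv_modelκ' p y hy
where
  /-- `inl (a · b) = inl a · inl b` as elements of `Π_C` (bookkeeping). [cite: MochizukiEtTh2009, Def 2.1 p.36] -/
  map_inl_mul (a b : PiHtκ p) :
      (SemidirectProduct.inl (a * b) : PiCκ p) = SemidirectProduct.inl a * SemidirectProduct.inl b := map_mul _ a b

/-- **hιtheta HOLDS at `piCDataκ'`** (`ι` acts on `Δ̄_Θ` by `+1`), by abc-iut-L6-d6's `inv_theta_of_inv_ell`.
[cite: MochizukiEtTh2009, Prop 2.2 (i) p.37] -/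
theorem piCDataκ'_inv_theta (l : ℕ) (e : (ThetaSetting.modelκ' p).OncePuncturedData) :
    ∀ c ∈ (piCDataκ' p).augGK.ker, c ∉ (piCDataκ' p).PiX →
      ∀ t ∈ (piCDataκ' p).barTheta l, c * t * c⁻¹ * t⁻¹ ∈ (piCDataκ' p).barKer l :=
  (piCDataκ' p).inv_theta_of_inv_ell l e (piCDataκ'_inv_ell p l e)

/-! ## §4. THE PAYOFF: hIx PROVED, `coverDataAx` with zero binders, Prop. 2.2 (i)(ii)(iii) instantiated -/

/-- **hIx HOLDS at `piCDataκ'`** for every `l > 0`: «`I_x ⥲ Δ̄_Θ`», i.e. `(D_x ∩ Δ_C) · Ker(Δ_X ↠ Δ̄_X) = Δ̄_Θ`-preimage in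
`Π_C` — by this seat's bridge `inertia_sup_barKer_of_commutatorAxis` at K3b's commutator-axis clause (compact `D_x`,
generating pair `inl(η a), inl(η b)`). [cite: MochizukiEtTh2009, Def 2.1 p.35] -/
theorem piCDataκ'_hIx (l : ℕ) (hl : 0 < l) (e : (ThetaSetting.modelκ' p).OncePuncturedData)
    (x : (ThetaSetting.modelκ' p).Pt) :
    ((piCDataκ' p).Dx x ⊓ (piCDataκ' p).augGK.ker) ⊔ (piCDataκ' p).barKer l = (piCDataκ' p).barTheta l :=
  (piCDataκ' p).inertia_sup_barKer_of_commutatorAxis l hl e x (isCompact_cuspDecompκ p)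
    (closure_pair_inl_eta_eq_top p) (map_toHat_inertia_modelκ' p x)

/-- **`coverDataAx` FULLY INSTANTIATED**: the `ThetaCovers.CoverDataAx l` of abc-iut-L2-t10's `PiCData.coverDataAx`
(p428054) at `modelκ′`, its cusp, its once-punctured parameters and `piCDataκ'` — with ALL binders discharged (odd `l`).
[cite: MochizukiEtTh2009, Def 2.1 p.36] -/
def coverDataAxκ (l : ℕ) (hodd : Odd l) : ThetaCovers.CoverDataAx.{0} l :=
  let e := (nonempty_oncePuncturedData_modelκ' p).some
  have hl : 0 < l := by obtain ⟨k, hk⟩ := hodd; omega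
  (piCDataκ' p).coverDataAx l e (x := ()) trivial hodd (piCDataκ'_hIx p l hl e ())
    (piCDataκ'_inv_ell p l e) (piCDataκ'_inv_theta p l e)

/-- **[EtTh] Prop. 2.2 (i) INSTANTIATED** (abc-iut-L2-t2's named fact `CoverData.Prop22_i` at a model with zero binders).
[cite: MochizukiEtTh2009, Prop 2.2(i) p.37] -/
theorem prop22_i_modelκ' (l : ℕ) (hodd : Odd l) : (coverDataAxκ p l hodd).toCoverData.Prop22_i :=
  (coverDataAxκ p l hodd).prop22_i_holds

/-- **[EtTh] Prop. 2.2 (ii) INSTANTIATED.** [cite: MochizukiEtTh2009, Prop 2.2(ii) p.37] -/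
theorem prop22_ii_modelκ' (l : ℕ) (hodd : Odd l) : (coverDataAxκ p l hodd).toCoverData.Prop22_ii :=
  (coverDataAxκ p l hodd).prop22_ii_holds

/-- **[EtTh] Prop. 2.2 (iii) INSTANTIATED.** [cite: MochizukiEtTh2009, Prop 2.2(iii) p.37] -/
theorem prop22_iii_modelκ' (l : ℕ) (hodd : Odd l) : (coverDataAxκ p l hodd).toCoverData.Prop22_iii :=
  (coverDataAxκ p l hodd).prop22_iii_holds

/-- CENSUS HEADLINE: the §2 cover constructor over an [EtTh] §1 theta setting has an instance with every printed input
supplied — once-punctured parameters exist and `∃ I x`, a cusp, with hIx ∧ hιell ∧ hιtheta — at `modelκ′` (`l > 0`).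
[cite: MochizukiEtTh2009, Def 2.1 p.36] -/
theorem exists_coverDataAx_all_binders (l : ℕ) (hl : 0 < l) :
    Nonempty (ThetaSetting.modelκ' p).OncePuncturedData ∧
    ∃ (I : (ThetaSetting.modelκ' p).PiCData (PiCκ p)) (x : (ThetaSetting.modelκ' p).Pt),
      (ThetaSetting.modelκ' p).IsCusp x ∧
      ((I.Dx x ⊓ I.augGK.ker) ⊔ I.barKer l = I.barTheta l) ∧
      (∀ c ∈ I.augGK.ker, c ∉ I.PiX → ∀ d ∈ I.PiX ⊓ I.augGK.ker, c * d * c⁻¹ * d ∈ I.barTheta l) ∧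
      (∀ c ∈ I.augGK.ker, c ∉ I.PiX → ∀ t ∈ I.barTheta l, c * t * c⁻¹ * t⁻¹ ∈ I.barKer l) := by
  obtain ⟨e⟩ := nonempty_oncePuncturedData_modelκ' p
  exact ⟨⟨e⟩, piCDataκ' p, (), trivial, piCDataκ'_hIx p l hl e (), piCDataκ'_inv_ell p l e,
    piCDataκ'_inv_theta p l e⟩

end Literature.AnabelianGeometry.EtaleTheta.SettingModel

end
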